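import Summits.QuantumFields.BalabanUV.Beta.FP.TowerRootCentred
import Summits.QuantumFields.BalabanUV.Beta.CompositeStencilWardRootedDM
import Summits.QuantumFields.BalabanUV.Beta.CompositeVertexWardRootedTwoLetter

/-!
# `BalabanUV.Beta.FP.TowerRootCentredComposed` — row D1 ∕ (C1), PART 109: THE COMPOSED ROOT OF THE CENTRED ONE-STEP ROOTS IS THE END's BIG ROOT,
# AND THE ROOTED-COMPOSITE WARD LETTERS (PART 105b ∕ 106c ∕ 108) RE-SPELLED AT THE CENTRED ROOTS OF RECORD `Roots.ctr Lc`

HONEST DEPENDENCY (page 1, mandatory): continuum YM on T⁴ ⇐ BetaPertH ∧ nine spine estimates (0/9 proved); BetaPertH ⇐ (D1) ∧ (D4) ∧ CAP+tail;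
G-an2-4 gates asym, D1 and NE2/3/4.  HONEST FRAMING (cell contract, verbatim): «discharging `BetaPertH` makes Bałaban's UV stability UNCONDITIONAL —
a real constructive-QFT result; it is NOT the continuum limit and NOT the Clay problem.»  ABSOLUTE RULE (cell charter, verbatim): «No internally-minted
“Prop := True” or trivially-inhabited predicates, no re-declaration of an already-stated crux in weaker form while calling it the crux, no postulating
the conclusion.»  Nothing here is an estimate of Bałaban's; `[folklore]` arithmetic of odd centres and `rw`-re-spellings of tree theorems.

WHAT.  PART 105a∕b (`CompositeVertexWardRooted[Packed]`), 106c (`CompositeVertexWardRootedTwoLetter`) and 108 (`CompositeStencilWardRootedDM`) state the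
(S)∕(W)-letters of the rooted composite tables with the COMPOSED root `Σ_{k<m} Lc^k • toSite (r k)` of the one-step in-block roots `r k`; the (3a) END
(`EndToEndBetaSkeleton`, `TowerNWardOfTableLaws`) reads the tower at the centred roots of record `Roots.ctr Lc` (`rc k = ctrOff 4 Lc`, big root
`s m = ctrOff 4 (Lc^m)`, `CompositeOneShotJetData.Roots.ctr`).  §1 is the junction (odd `Lc`): `Σ_{k<m} Lc^k • toSite (ctrOff (d+1) Lc) = toSite (ctrOff (d+1) (Lc^m))`
— coordinatewise `((Lc−1)∕2)·(1 + Lc + ⋯ + Lc^{m−1}) = (Lc^m − 1)∕2` — typed by the kernel chair b2b-balaban-beta-d1-formalise-leaf-03 g68 as PROBE-K3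
(`xvp/probe/PROBE-K3-composedRoot.lean`, rc 0, unfiled under the chair's freeze) from leaf-05's one-step identity `TowerRootCentred.mul_half_pred_add_half_pred`,
and ADOPTED HERE VERBATIM with that credit.  §2 re-spells the five rooted-composite letters at `R := Roots.ctr Lc` with the big root in place of the composed root.
-/

open Finset
open scoped BigOperators
open Literature.MathematicalPhysics.QuantumFieldTheory
open Literature.MathematicalPhysics.QuantumFieldTheory.Balaban1983to89
open Literature.MathematicalPhysics.QuantumFieldTheory.Balaban1983to89.Beta
open ExpKernelCalculus (MKer VertexFamily comp)
open OneStepResolventKernel (Fib)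
open KernelWard (divV)
open AffineAveraging (Site box toSite)
open AveragingContoursRooted (ctrOff)
open AveragingHessianKernelsRooted (linKerAt vhKerAt)
open SecondOrderResponse (dM)
open Summit.QuantumFields.BalabanUV.Beta.ChartConjugation (conjV)
open Summit.QuantumFields.BalabanUV.Beta.BorderedHessian (diagK)
open Summit.QuantumFields.BalabanUV.Beta.AveragingWardRootedStencils (legInd)
open Summit.QuantumFields.BalabanUV.Beta.AxialDressingRooted (one_le_of_neZero)
open Summit.QuantumFields.BalabanUV.Beta.SpineRooted (S0NOf SpureRecOf)
open Summit.QuantumFields.BalabanUV.Beta.RelInvComposite (bhKcomp)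
open Summit.QuantumFields.BalabanUV.Beta.CompositeVertexKernelRec (compVhS compVh2S)
open Summit.QuantumFields.BalabanUV.Beta.CompositeVertexKernelBoundsTwoSym (vh2KerSymAt)
open Summit.QuantumFields.BalabanUV.Beta.SecondOrderSocketIdentification (atw)
open Summit.QuantumFields.BalabanUV.Beta.CompositeOneShotJetData (Roots AN)
open Summit.QuantumFields.BalabanUV.Beta.FP.TowerRootCentred (mul_half_pred_add_half_pred toSite_ctrOff_apply)
open Summit.QuantumFields.BalabanUV.Beta.CompositeVertexWardRootedPacked (hSd_S0NOf_compVhS_rooted)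
open Summit.QuantumFields.BalabanUV.Beta.CompositeVertexWardRootedTwoLetter (hBord_compB_rooted hBord''_compB_rooted)
open Summit.QuantumFields.BalabanUV.Beta.CompositeStencilWardRootedDM (hSd_SpureRecOf_compVhS_rooted divV_dM_AN_compVhS_rooted)

namespace Summit.QuantumFields.BalabanUV.Beta.FP.TowerRootCentredComposed

/-! ## §1 The composed root of centred one-step roots (chair leaf-03 g68, PROBE-K3, verbatim) -/

/-- [folklore] **THE COMPOSED ROOT OF CENTRED ONE-STEP ROOTS IS THE CENTRED OFFSET OF THE BIG BLOCK** (`Σ_{k<m}` spelling; odd `Lc`):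
`Σ_{k<m} Lc^k • toSite (ctrOff (d+1) Lc) = toSite (ctrOff (d+1) (Lc^m))` — coordinatewise `((Lc−1)∕2)·(1 + Lc + ⋯ + Lc^{m−1}) = (Lc^m − 1)∕2`
(typed by the kernel chair leaf-03 g68, PROBE-K3). -/
theorem sum_range_pow_smul_toSite_ctrOff {d Lc : ℕ} (hLc : Odd Lc) :
    ∀ m : ℕ, ∑ k ∈ Finset.range m, ((Lc ^ k : ℕ) : ℤ) • toSite (ctrOff (d + 1) Lc) = toSite (ctrOff (d + 1) (Lc ^ m))
  | 0 => by
    funext i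
    rw [Finset.sum_range_zero, toSite_ctrOff_apply, pow_zero]
    rfl
  | m + 1 => by
    rw [Finset.sum_range_succ, sum_range_pow_smul_toSite_ctrOff hLc m]
    funext i
    rw [Pi.add_apply, Pi.smul_apply, smul_eq_mul, toSite_ctrOff_apply, toSite_ctrOff_apply, toSite_ctrOff_apply, add_comm, pow_succ]
    exact mul_half_pred_add_half_pred hLc (hLc.pow (n := m))

/-- [folklore] **AT THE (β1) TOWER's CENTRED ROOTS OF RECORD** (`Roots.ctr Lc`: `rc k = ctrOff 4 Lc`, `s m = ctrOff 4 (Lc^m)`): PART 105a∕b's composed root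
`Σ_{k<m} Lc^k • toSite ((Roots.ctr Lc).rc k)` IS the END's big root `toSite ((Roots.ctr Lc).s m)` (odd `Lc`; chair leaf-03 g68, PROBE-K3). -/
theorem ctr_composedRoot_eq_s {Lc : ℕ} [NeZero Lc] (hLc : Odd Lc) (m : ℕ) :
    ∑ k ∈ Finset.range m, ((Lc ^ k : ℕ) : ℤ) • toSite ((Roots.ctr Lc).rc k) = toSite ((Roots.ctr Lc).s m) :=
  sum_range_pow_smul_toSite_ctrOff (d := 3) hLc m

/-- [folklore] the same with the big root read as the centre `AveragingContoursRooted.ctr 4 (Lc^m)` (`Roots.toSite_ctr_s`, `rfl`). -/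
theorem ctr_composedRoot_eq_ctr {Lc : ℕ} [NeZero Lc] (hLc : Odd Lc) (m : ℕ) :
    ∑ k ∈ Finset.range m, ((Lc ^ k : ℕ) : ℤ) • toSite ((Roots.ctr Lc).rc k) = AveragingContoursRooted.ctr (3 + 1) (Lc ^ m) :=
  ctr_composedRoot_eq_s hLc m

/-- kernel example (by §1): `Lc = 3`, depth 2: `1•(1,1,1,1) + 3•(1,1,1,1) = (4,4,4,4) = toSite (ctrOff 4 9)`. -/
example : ∑ k ∈ Finset.range 2, ((3 ^ k : ℕ) : ℤ) • toSite (ctrOff 4 3) = toSite (ctrOff 4 9) := by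
  rw [sum_range_pow_smul_toSite_ctrOff (d := 3) (by decide : Odd 3) 2]; norm_num

/-! ## §2 The rooted-composite Ward letters at the centred roots of record, big-root spelling -/

section Ctr

variable (Lc : ℕ) [NeZero Lc]

/-- [folklore] **PART 105b's (S)-law `hSd_S0NOf_compVhS_rooted` AT `Roots.ctr Lc`** (odd `Lc`, `d = 3`): the diagonal generator is supported on the legs of the
END's big root `toSite ((Roots.ctr Lc).s m)`. -/
theorem hSd_S0NOf_compVhS_ctr (hLc : Odd Lc) (m : ℕ) [NeZero (Lc ^ m)]
    (H : Fin (3 + 1) → (Fin (3 + 1) → ℤ) → MKer (3 + 1) (Fib 3)) (hH : ∀ δ : ℝ, 0 ≤ δ → ∃ C : ℝ, VertexFamily H (Lc ^ m) C δ)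
    {cE cVH cH ξ : ℝ} (cΛ : ℝ) (h₁ : cH * cE * (1 / 2) = ξ) (h₂ : cH * cVH = -(ξ * ((Lc : ℝ) ^ (3 + 1)) ^ m)) (y : Site (3 + 1)) :
    cH • ∑ v ∈ box (3 + 1) (Lc ^ m), divV (S0NOf 3 (Lc ^ m)
        (compVhS (fun k => linKerAt (toSite ((Roots.ctr Lc).rc k)) Lc) (fun k => vhKerAt (toSite ((Roots.ctr Lc).rc k)) Lc) Lc m) H cE cVH cΛ)
        (((Lc ^ m : ℕ) : ℤ) • y + toSite v) =
      conjV (bhKcomp (d := 3) (Roots.ctr Lc).rc Lc m) (diagK (ξ • ∑ v ∈ box (3 + 1) (Lc ^ m),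
        legInd (toSite ((Roots.ctr Lc).s m)) (((Lc ^ m : ℕ) : ℤ) • y + toSite v))) := by
  rw [← ctr_composedRoot_eq_s hLc m]
  exact hSd_S0NOf_compVhS_rooted (one_le_of_neZero Lc) (Roots.ctr Lc).hrc m H hH cΛ h₁ h₂ y

/-- [folklore] **PART 106c's border letter `hBord_compB_rooted` AT `Roots.ctr Lc`** (odd `Lc`, `d = 3`; lock `cH·cB = ξ·cVH`; remainder zero). -/
theorem hBord_compB_ctr (hLc : Odd Lc) (m : ℕ) {cH cB cVH ξ : ℝ} (hlock : cH * cB = ξ * cVH)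
    (Y : Site (3 + 1)) (κ' : Fin (3 + 1)) (u' : Site (3 + 1)) :
    cH • ∑ v ∈ box (3 + 1) (Lc ^ m), divV (fun κ u => cB • atw (compVh2S (fun k => linKerAt (toSite ((Roots.ctr Lc).rc k)) Lc)
        (fun k => vhKerAt (toSite ((Roots.ctr Lc).rc k)) Lc) (fun k => vh2KerSymAt (toSite ((Roots.ctr Lc).rc k)) Lc) Lc m κ u κ' u'))
        (((Lc ^ m : ℕ) : ℤ) • Y + toSite v) =
      comp (cVH • compVhS (fun k => linKerAt (toSite ((Roots.ctr Lc).rc k)) Lc) (fun k => vhKerAt (toSite ((Roots.ctr Lc).rc k)) Lc) Lc m κ' u')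
          (diagK (ξ • ∑ v ∈ box (3 + 1) (Lc ^ m), legInd (toSite ((Roots.ctr Lc).s m)) (((Lc ^ m : ℕ) : ℤ) • Y + toSite v))) -
        comp (diagK (ξ • ∑ v ∈ box (3 + 1) (Lc ^ m), legInd (toSite ((Roots.ctr Lc).s m)) (((Lc ^ m : ℕ) : ℤ) • Y + toSite v)))
          (cVH • compVhS (fun k => linKerAt (toSite ((Roots.ctr Lc).rc k)) Lc) (fun k => vhKerAt (toSite ((Roots.ctr Lc).rc k)) Lc) Lc m κ' u') := by
  rw [← ctr_composedRoot_eq_s hLc m]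
  exact hBord_compB_rooted (one_le_of_neZero Lc) (Roots.ctr Lc).hrc m hlock Y κ' u'

/-- [folklore] **PART 106c's second-slot border letter `hBord''_compB_rooted` AT `Roots.ctr Lc`** (odd `Lc`, `d = 3`). -/
theorem hBord''_compB_ctr (hLc : Odd Lc) (m : ℕ) {cH cB cVH ξ : ℝ} (hlock : cH * cB = ξ * cVH)
    (Y : Site (3 + 1)) (κ : Fin (3 + 1)) (u : Site (3 + 1)) :
    cH • ∑ v ∈ box (3 + 1) (Lc ^ m), divV (fun κ' u' => cB • atw (compVh2S (fun k => linKerAt (toSite ((Roots.ctr Lc).rc k)) Lc)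
        (fun k => vhKerAt (toSite ((Roots.ctr Lc).rc k)) Lc) (fun k => vh2KerSymAt (toSite ((Roots.ctr Lc).rc k)) Lc) Lc m κ u κ' u'))
        (((Lc ^ m : ℕ) : ℤ) • Y + toSite v) =
      comp (cVH • compVhS (fun k => linKerAt (toSite ((Roots.ctr Lc).rc k)) Lc) (fun k => vhKerAt (toSite ((Roots.ctr Lc).rc k)) Lc) Lc m κ u)
          (diagK (ξ • ∑ v ∈ box (3 + 1) (Lc ^ m), legInd (toSite ((Roots.ctr Lc).s m)) (((Lc ^ m : ℕ) : ℤ) • Y + toSite v))) -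
        comp (diagK (ξ • ∑ v ∈ box (3 + 1) (Lc ^ m), legInd (toSite ((Roots.ctr Lc).s m)) (((Lc ^ m : ℕ) : ℤ) • Y + toSite v)))
          (cVH • compVhS (fun k => linKerAt (toSite ((Roots.ctr Lc).rc k)) Lc) (fun k => vhKerAt (toSite ((Roots.ctr Lc).rc k)) Lc) Lc m κ u) := by
  rw [← ctr_composedRoot_eq_s hLc m]
  exact hBord''_compB_rooted (one_le_of_neZero Lc) (Roots.ctr Lc).hrc m hlock Y κ u

/-- [folklore] **PART 108's (S)-law of the pure slotted spine `hSd_SpureRecOf_compVhS_rooted` AT `Roots.ctr Lc`** (odd `Lc`; lattice `Lc^(j+1)`). -/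
theorem hSd_SpureRecOf_compVhS_ctr (hLc : Odd Lc) (j : ℕ) (H : Fin (3 + 1) → (Fin (3 + 1) → ℤ) → MKer (3 + 1) (Fib 3))
    (hH : ∀ δ : ℝ, 0 ≤ δ → ∃ C : ℝ, VertexFamily H (Lc ^ (j + 1)) C δ) (G : ℕ → MKer (3 + 1) (Fib 3))
    {cE cVH cH ξ : ℝ} (cΛ : ℝ) (h₁ : cH * cE * (1 / 2) = ξ) (h₂ : cH * cVH = -(ξ * ((Lc : ℝ) ^ (3 + 1)) ^ (j + 1))) (y : Site (3 + 1)) :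
    cH • ∑ v ∈ box (3 + 1) (Lc ^ (j + 1)), divV (SpureRecOf 3 (Lc ^ (j + 1))
        (compVhS (fun k => linKerAt (toSite ((Roots.ctr Lc).rc k)) Lc) (fun k => vhKerAt (toSite ((Roots.ctr Lc).rc k)) Lc) Lc (j + 1)) H G cE cVH cΛ 0)
        ((((Lc ^ (j + 1) : ℕ) : ℤ)) • y + toSite v) =
      conjV (bhKcomp (d := 3) (Roots.ctr Lc).rc Lc (j + 1)) (diagK (ξ • ∑ v ∈ box (3 + 1) (Lc ^ (j + 1)),
        legInd (toSite ((Roots.ctr Lc).s (j + 1))) ((((Lc ^ (j + 1) : ℕ) : ℤ)) • y + toSite v))) := by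
  rw [← ctr_composedRoot_eq_s hLc (j + 1)]
  exact hSd_SpureRecOf_compVhS_rooted (Roots.ctr Lc) j H hH G cΛ h₁ h₂ y

/-- [folklore] **PART 108's `hDᴿ` `divV_dM_AN_compVhS_rooted` AT `Roots.ctr Lc`** (odd `Lc`): the first-order Ward law of the unfolded vertex `dM (AN (Roots.ctr Lc) j) …`
over the rooted composite V-table, with the END's big root `toSite ((Roots.ctr Lc).s (j+1))` on the generator. -/
theorem divV_dM_AN_compVhS_ctr (hLc : Odd Lc) (j : ℕ) (H : Fin (3 + 1) → (Fin (3 + 1) → ℤ) → MKer (3 + 1) (Fib 3))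
    (hH : ∀ δ : ℝ, 0 ≤ δ → ∃ C : ℝ, VertexFamily H (Lc ^ (j + 1)) C δ) (G : ℕ → MKer (3 + 1) (Fib 3))
    (hG : ∀ k : ℕ, ∃ δ C : ℝ, 0 < δ ∧ 0 ≤ C ∧ ExpKernelCalculus.Decays (G k) C δ)
    {M₀ : Fin (3 + 1) → (Fin (3 + 1) → ℤ) → MKer (3 + 1) (Fib 3)} {B : ℝ} (hM₀ : ∀ ρ w x z a b, |M₀ ρ w x z a b| ≤ B)
    {cE cVH ξ : ℝ} (cΛ : ℝ) (h₁ : ((((Lc ^ (j + 1) : ℕ) : ℝ)) ^ (3 + 1))⁻¹ * cE * (1 / 2) = ξ)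
    (h₂ : ((((Lc ^ (j + 1) : ℕ) : ℝ)) ^ (3 + 1))⁻¹ * cVH = -(ξ * ((Lc : ℝ) ^ (3 + 1)) ^ (j + 1))) (y : Site (3 + 1)) :
    divV (dM (AN (Roots.ctr Lc) j) (Lc ^ (j + 1)) (SpureRecOf 3 (Lc ^ (j + 1))
        (compVhS (fun k => linKerAt (toSite ((Roots.ctr Lc).rc k)) Lc) (fun k => vhKerAt (toSite ((Roots.ctr Lc).rc k)) Lc) Lc (j + 1))
        H G cE cVH cΛ 0) M₀) y =
      conjV (bhKcomp (d := 3) (Roots.ctr Lc).rc Lc (j + 1)) (diagK (ξ • ∑ v ∈ box (3 + 1) (Lc ^ (j + 1)),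
        legInd (toSite ((Roots.ctr Lc).s (j + 1))) ((((Lc ^ (j + 1) : ℕ) : ℤ)) • y + toSite v))) := by
  rw [← ctr_composedRoot_eq_s hLc (j + 1)]
  exact divV_dM_AN_compVhS_rooted (Roots.ctr Lc) j H hH G hG hM₀ cΛ h₁ h₂ y

end Ctr

end Summit.QuantumFields.BalabanUV.Beta.FP.TowerRootCentredComposed
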